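import Summits.KontsevichZagierPeriods.KontsevichZagierPeriods.Theorems.SymplecticScissorsPlanarK0InjectiveCellReading

/-!
# `PlanarK0Injective` (stmt-KontsevichZagierPeriods-9847) — line `kernel-subgroup-homotopy`,
stub `stub_reading`

SIGNED CELL READING of a difference of two planar sets (integrand `1`): modulo the planar
set-chain group `planarGroup`, `[r] − [r'] ≡ Σ εᵢ [cᵢ]` with STANDARD cells
`cᵢ = {0 < x < 1, 0 < y < gᵢ x}` (`gᵢ` `ℚ`-semialgebraic, `C¹`, positive and integrable on
`(0,1)`), signs `εᵢ = ±1`, and the signed areas add up to `value r − value r'`.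

This is the landed one-set cell reading `MordellWeil.stub_cellReading` applied to `r` (signs `+1`)
and to `r'` (signs `−1`), glued along `Fin.append`; the value identity is soundness of the planar
set-chain group (`eval_eq_zero_of_mem_planarGroup`). [Kontsevich–Zagier 2001, §1.2; folklore]
-/

noncomputable section

open MeasureTheory Set
open Literature.NumberTheory.Transcendental Literature.ModelTheory.ExponentialFields
open Summit.KontsevichZagierPeriods.SymplecticScissors.PlanarK0InjectiveNegative (planarGroup
  eval_eq_zero_of_mem_planarGroup)

namespace Summit.KontsevichZagierPeriods.SymplecticScissors.KernelSubgroupHomotopy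

/-- Soundness of the planar set-chain group on a cell reading: if `[c] ≡ Σ [dᵢ]` modulo
`planarGroup`, then `value c = Σ value dᵢ`. [folklore] -/
private theorem reading_value_eq_sum {k : ℕ} (c : KZ.IntegralRep 2)
    (d : Fin k → KZ.IntegralRep 2) (h : KZ.of c - ∑ i, KZ.of (d i) ∈ planarGroup) :
    c.value = ∑ i, (d i).value := by
  have h0 := eval_eq_zero_of_mem_planarGroup h
  simp only [map_sub, map_sum, KZ.eval_of] at h0
  linarith

/-- **Stub 1 (signed cell reading).** Two planar sets (integrand `1`) differ, modulo the planar
set-chain group, by a signed sum of standard cells `{0 < x < 1, 0 < y < g x}` (`g`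
`ℚ`-semialgebraic, `C¹`, positive and integrable on `(0,1)`), and the signed areas add up to
`value r − value r'`. [Kontsevich–Zagier 2001, §1.2; folklore] -/
theorem stub_reading :
    ∀ (r r' : KZ.IntegralRep 2), (∀ p ∈ r.domain, r.integrand p = 1) →
      (∀ p ∈ r'.domain, r'.integrand p = 1) →
      ∃ (k : ℕ) (g : Fin k → ℝ → ℝ) (ε : Fin k → ℤ) (c : Fin k → KZ.IntegralRep 2),
        (∀ i, IsSemialgebraicFunOn ℚ {z : Fin 1 → ℝ | z 0 ∈ Set.Ioo (0 : ℝ) 1} (fun z => g i (z 0)) ∧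
          ContDiffOn ℝ 1 (g i) (Set.Ioo (0 : ℝ) 1) ∧ (∀ x ∈ Set.Ioo (0 : ℝ) 1, 0 < g i x) ∧
          IntegrableOn (g i) (Set.Ioo (0 : ℝ) 1)) ∧
        (∀ i, ε i = 1 ∨ ε i = -1) ∧
        (∀ i, (c i).domain = {p : Fin 2 → ℝ | p 0 ∈ Set.Ioo (0 : ℝ) 1 ∧ 0 < p 1 ∧ p 1 < g i (p 0)} ∧
          ∀ p ∈ (c i).domain, (c i).integrand p = 1) ∧
        ∑ i, (ε i : ℝ) * (c i).value = r.value - r'.value ∧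
        (KZ.of r - KZ.of r') - ∑ i, ε i • KZ.of (c i) ∈ planarGroup := by
  intro r r' hr hr'
  obtain ⟨n, g, c, hg, hc, hm⟩ := MordellWeil.stub_cellReading r hr
  obtain ⟨n', g', c', hg', hc', hm'⟩ := MordellWeil.stub_cellReading r' hr'
  have hv : r.value = ∑ i, (c i).value := reading_value_eq_sum r c hm
  have hv' : r'.value = ∑ i, (c' i).value := reading_value_eq_sum r' c' hm'
  refine ⟨n + n', Fin.append g g',
    Fin.append (fun _ : Fin n => (1 : ℤ)) (fun _ : Fin n' => (-1 : ℤ)), Fin.append c c',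
    ?_, ?_, ?_, ?_, ?_⟩
  · refine Fin.addCases (fun i => ?_) (fun i => ?_)
    · simpa only [Fin.append_left] using hg i
    · simpa only [Fin.append_right] using hg' i
  · refine Fin.addCases (fun i => ?_) (fun i => ?_)
    · exact Or.inl (by simp only [Fin.append_left])
    · exact Or.inr (by simp only [Fin.append_right])
  · refine Fin.addCases (fun i => ?_) (fun i => ?_)
    · simpa only [Fin.append_left] using hc i
    · simpa only [Fin.append_right] using hc' i
  · rw [Fin.sum_univ_add]
    simp only [Fin.append_left, Fin.append_right, Int.cast_one, one_mul, Int.cast_neg, neg_mul,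
      Finset.sum_neg_distrib, hv, hv']
    ring
  · rw [Fin.sum_univ_add]
    simp only [Fin.append_left, Fin.append_right, one_smul, neg_smul, Finset.sum_neg_distrib]
    convert sub_mem hm hm' using 1
    abel

end Summit.KontsevichZagierPeriods.SymplecticScissors.KernelSubgroupHomotopy

end
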